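import Summits.HodgeConjecture.HodgeConjecture.Theorems.Ring2HypothesesDescentAbsoluteMiddleGeneral
import HarnessLib

/-!
# Ring 2 — hypotheses layer, descent axis: ROW b06 AND ITS PARENT NODE LIVE IN EVERY FIXED OFFSET FROM THE MIDDLE DEGREE
# ("absolute Hodge classes in `H^{2q}` of varieties of dimension `2q − k`", resp. `2q + k`, for ANY fixed `k`) — modulo (N)+(E)+(c)

HONEST FRAMING (page 1, verbatim the cell's standing line): **research route conditional on HC_CM; not a
corollary; Q11.4-sentence-2 already refuted in dim ≥ 3.** Nothing in this file proves a case of the Hodge conjecture;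
nothing discharges the binder of record b06 `Ring2.Hypotheses.AbsoluteHodgeImpliesAlgebraicAV` or its parent node
`AbsoluteHodgeImpliesAlgebraic` (`Ring2HypothesesDescent.lean` :73 / :66; both OPEN); the binder table's numbers do not
move. `HC_CM` (`Theses.RankFourFaces.CMAbelianHodge`) does not occur in this file; `HC_AV` is not asserted.

Hodge ladder STAGE 3, `BINDER-OWNERS.md` row **b06**, seat `ring2-b06` (gen 72). Call the OFFSET of a class of `H^{2q}(Y(ℂ); ℂ)`
on an `N`-fold `Y` the integer `2q − N` (offset `0` = the middle degree; hard Lefschetz pairs offsets `±k`). Gen 69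
(`absoluteHodgeImpliesAlgebraicAV_iff_middleDegree_of_canonical`) and gen 71 (`absoluteHodgeImpliesAlgebraic_iff_middleDegree_of_canonical`)
put row b06 and its parent node in offset `0`. The two paddings of those files move a class to ANY prescribed offset, in both
directions, on general smooth projective varieties and WITHOUT `B(X)`:

* DOWN by `j` (gen 69, (N)+(E), fact-free descent): `c ↦ pr_X^* c` on `X × B`, `dim B = j`; back by the slice `X × {t}`
  (`absoluteHodge_algebraic_of_prod_of_canonical`, ring2-b02's `mem_algebraicClasses_of_map_fst_mem`);
* UP by `j` (gen 71, (N)+(E)+(c), fact-free descent): `c ↦ pr_X^* c ∪ pr_B^* κʲ`, `κ` a polarisation class of the `j`-fold `B`;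
  back by the Gysin push-forward `pr_{X*}` (`absoluteHodge_algebraic_of_middle_prod_of_canonical`,
  `mem_algebraicClasses_of_cross_top_mem`).

Hence, for EVERY natural number `k` (this file; the case `k = 0` of either theorem is gen 69 / gen 71):

* §1 **`absoluteHodgeImpliesAlgebraic_iff_aboveMiddleBy_of_canonical k`: the parent node `↔` "on every smooth projective
  complex `Y` of dimension `N`, every absolute Hodge class of codimension `q` with `2q = N + k` (`2 ≤ q ≤ N − 2`) is
  algebraic"** and **`absoluteHodgeImpliesAlgebraic_iff_belowMiddleBy_of_canonical k`**: the same with `2q + k = N`. E.g.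
  `k = 1`: it suffices to treat absolute Hodge classes of codimension `q` on `(2q − 1)`-folds — or on `(2q + 1)`-folds; `k = 100`:
  classes of codimension `q` on `(2q + 100)`-folds.
* §2 the ROW-b06 twins **`absoluteHodgeImpliesAlgebraicAV_iff_aboveMiddleBy_of_canonical k`** /
  **`absoluteHodgeImpliesAlgebraicAV_iff_belowMiddleBy_of_canonical k`** (abelian varieties are closed under the paddings:
  `(A × B).X = A.X × B.X`, `dim (A × B) = dim A + dim B`).
* §3 (G)-keyed forms.

Mechanism (per variety, `forall_absoluteHodge_algebraic_lowerHalf_of_aboveMiddleBy_of_canonical` etc.): by gen 68's halving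
(`absoluteHodgeImpliesAlgebraic_iff_lowerHalf`, (c)) only classes of codimension `2 ≤ p`, `2p ≤ n` matter; such a class has
offset `2p − n ≤ 0` and is padded up by `j = (n − 2p) + k` to offset `k`, resp. up by `(n − 2p) − k` or down by `k − (n − 2p)` to
offset `−k`; the window `2 ≤ q ≤ N − 2` is kept because `p ≤ n − 2`.

HONEST COLUMN. Nothing is discharged; «10 · 0» unchanged; row b06, parent node, `HC_AV` OPEN and NOT asserted; (N), (E)/(G),
(c) are named facts displayed as hypotheses; no definition, no named fact, no sorry; no new mathematics beyond gens 69/71 — the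
content is that the offset is a FREE parameter. NOT claimed: fixed-CODIMENSION forms (e.g. "codimension 2 suffices"), which
these paddings cannot reach; anything for the `ℚ̄`-variant.

References (bib keys): Deligne1982HodgeCycles (§2 Ex. 2.1 (c), (d) p. 16), CharlesSchnell2014Notes (Def. 11.2.3, §11.2.2
(11.2.2)–(11.2.3), Cor. 11.2.12, Conj. 11.2.18, Prop. 11.3.11), VoisinHodgeI2002 (Thm. 6.25, §7.1.2, Thm. 11.30),
VoisinHodgeII2003 (§9.2.4 Prop. 9.20, Prop. 9.21), BrosnanFangNiePearlstein2009 (§6 Lemma 48), KerrPearlstein2011 (§3.1),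
Lieberman1968 (main theorem), Fulton1998 (§10.1 Cor. 10.1), FultonYoungTableaux1997 (App. B §B.1 (5)–(7)), HatcherAT2002
(§3.3 Thm. 3.26), MumfordAV1970 (§1), SilvermanAEC2009 (III.3.6). -/

noncomputable section

set_option linter.dupNamespace false

open CategoryTheory AlgebraicGeometry MonoidalCategory CartesianMonoidalCategory
open Literature.AlgebraicTopology.SingularHomology Literature.Geometry.Kaehler
open Literature.AlgebraicGeometry Literature.AlgebraicGeometry.Motives
open Literature.AlgebraicGeometry.HodgeTheory
open Summit.HodgeConjecture.HodgeConjecture.Theorems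

namespace Summit.HodgeConjecture.HodgeConjecture.Ring2.Hypotheses

/-! ## §1 The parent node at a fixed offset `±k` from the middle (modulo (N)+(E)+(c)) -/

section Parent

variable {n : ℕ} {X : SchemeOver ℂ}

/-- **PER VARIETY, OFFSET `+k`**: granted (N), (E), (c), if on every smooth projective `Y` of dimension `N` every absolute Hodge
class of codimension `q` with `2q = N + k`, `2 ≤ q ≤ N − 2` is algebraic, then on the smooth projective `n`-fold `X` every absolute
Hodge class of codimension `2 ≤ p`, `2p ≤ n` is algebraic: pad UP by a polarised abelian variety `B` of dimension
`j = (n − 2p) + k` (`pr_X^* c ∪ pr_B^* κʲ` is absolute Hodge of codimension `p + j` on the `(n+j)`-fold `X × B`, offset `k`; gen 71's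
`absoluteHodge_algebraic_of_middle_prod_of_canonical` descends by `pr_{X*}`); nothing to pad when `j = 0`. The hypothesis is NOT
asserted. [cite: Deligne1982HodgeCycles, §2 Example 2.1 (c), (d) (p. 16)] [cite: VoisinHodgeII2003, §9.2.4 Prop. 9.21]
[cite: BrosnanFangNiePearlstein2009, §6 Lemma 48] [cite: MumfordAV1970, §1] -/
theorem forall_absoluteHodge_algebraic_lowerHalf_of_aboveMiddleBy_of_canonical (hN : chartConjugation_canonical)
    (hex : ∀ ⦃n : ℕ⦄ ⦃X : SchemeOver ℂ⦄, IsSmoothProjective n X →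
      ∀ (σ : ℂ ≃+* ℂ) (p : ℕ) (c : complexBetti X (2 * p)), ∃ s, IsConjugateClass σ X (2 * p) c s)
    (h21c : deligne1982_lefschetz_absoluteHodge_iff) (k : ℕ)
    (hk : ∀ ⦃N : ℕ⦄ ⦃Y : SchemeOver ℂ⦄, IsSmoothProjective N Y → ∀ q : ℕ, 2 ≤ q → q + 2 ≤ N → 2 * q = N + k →
      ∀ z : complexBetti Y (2 * q), IsAbsoluteHodgeClass N Y q z → z ∈ algebraicClasses Y q)
    (hX : IsSmoothProjective n X) (p : ℕ) (hp : 2 ≤ p) (hpn : 2 * p ≤ n) (c : complexBetti X (2 * p))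
    (hc : IsAbsoluteHodgeClass n X p c) : c ∈ algebraicClasses X p := by
  obtain ⟨j, hj⟩ : ∃ j, 2 * p + j = n + k := ⟨n + k - 2 * p, by omega⟩
  rcases Nat.eq_zero_or_pos j with rfl | hj1
  · exact hk hX p hp (by omega) (by omega) c hc
  · obtain ⟨B, hBd⟩ := exists_abelianVariety_dim_eq_succ ℂ (j - 1)
    have hBsp : IsSmoothProjective B.dim B.X := AbelianVariety.isSmoothProjective_holds (A := B)
    obtain ⟨κ, hκ⟩ := exists_isPolarizationClass hBsp
    exact absoluteHodge_algebraic_of_middle_prod_of_canonical hN hex h21c hX hBsp hκ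
      (fun z hz ↦ hk (IsSmoothProjective.tensor_holds hX hBsp) (p + B.dim) (by omega) (by omega) (by omega) z hz) c hc

/-- **THE PARENT NODE AT OFFSET `+k`, FOR EVERY `k`**: granted (N), (E), (c), `AbsoluteHodgeImpliesAlgebraic ↔` "on every smooth
projective complex `Y` of dimension `N`, every absolute Hodge class of codimension `q` with `2q = N + k` and `2 ≤ q ≤ N − 2` is
algebraic" (`k = 0`: gen 71's middle-degree form; `k = 1`: classes of codimension `q` on `(2q − 1)`-folds). Lower half by the
previous theorem, the rest by gen 68's halving (`absoluteHodgeImpliesAlgebraic_iff_lowerHalf`). Neither side is asserted; NO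
`B(X)`. [cite: CharlesSchnell2014Notes, §11.2.5 Conj. 11.2.18 and Cor. 11.2.12] [cite: Deligne1982HodgeCycles, §2 Example 2.1 (c), (d) (p. 16)]
[cite: BrosnanFangNiePearlstein2009, §6 Lemma 48] -/
theorem absoluteHodgeImpliesAlgebraic_iff_aboveMiddleBy_of_canonical (hN : chartConjugation_canonical)
    (hex : ∀ ⦃n : ℕ⦄ ⦃X : SchemeOver ℂ⦄, IsSmoothProjective n X →
      ∀ (σ : ℂ ≃+* ℂ) (p : ℕ) (c : complexBetti X (2 * p)), ∃ s, IsConjugateClass σ X (2 * p) c s)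
    (h21c : deligne1982_lefschetz_absoluteHodge_iff) (k : ℕ) :
    AbsoluteHodgeImpliesAlgebraic ↔
      ∀ ⦃N : ℕ⦄ ⦃Y : SchemeOver ℂ⦄, IsSmoothProjective N Y → ∀ q : ℕ, 2 ≤ q → q + 2 ≤ N → 2 * q = N + k →
        ∀ z : complexBetti Y (2 * q), IsAbsoluteHodgeClass N Y q z → z ∈ algebraicClasses Y q :=
  ⟨fun h _ _ hY q _ _ _ z hz ↦ h hY q z hz,
    fun h ↦ (absoluteHodgeImpliesAlgebraic_iff_lowerHalf h21c).2 fun _ _ hX p hp hpn c hc ↦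
      forall_absoluteHodge_algebraic_lowerHalf_of_aboveMiddleBy_of_canonical hN hex h21c k h hX p hp hpn c hc⟩

/-- **PER VARIETY, OFFSET `−k`**: granted (N), (E), (c), if on every smooth projective `Y` of dimension `N` every absolute Hodge
class of codimension `q` with `2q + k = N`, `2 ≤ q` is algebraic, then on the smooth projective `n`-fold `X` every absolute Hodge class
of codimension `p ≥ 2` is algebraic: if `n ≤ 2p + k` pad DOWN by an abelian variety of dimension `k − (n − 2p)` (bare
pull-back `pr_X^* c`, gen 69's `absoluteHodge_algebraic_of_prod_of_canonical`, slice descent), otherwise pad UP by a polarised abelian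
variety of dimension `(n − 2p) − k` (gen 71). The hypothesis is NOT asserted. [cite: Deligne1982HodgeCycles, §2 Example 2.1 (c), (d) (p. 16)]
[cite: CharlesSchnell2014Notes, §11.2.2 (11.2.2) and Prop. 11.3.11 (proof)] [cite: VoisinHodgeII2003, §9.2.4 Prop. 9.21]
[cite: BrosnanFangNiePearlstein2009, §6 Lemma 48] -/
theorem forall_absoluteHodge_algebraic_of_two_le_of_belowMiddleBy_of_canonical (hN : chartConjugation_canonical)
    (hex : ∀ ⦃n : ℕ⦄ ⦃X : SchemeOver ℂ⦄, IsSmoothProjective n X →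
      ∀ (σ : ℂ ≃+* ℂ) (p : ℕ) (c : complexBetti X (2 * p)), ∃ s, IsConjugateClass σ X (2 * p) c s)
    (h21c : deligne1982_lefschetz_absoluteHodge_iff) (k : ℕ)
    (hk : ∀ ⦃N : ℕ⦄ ⦃Y : SchemeOver ℂ⦄, IsSmoothProjective N Y → ∀ q : ℕ, 2 ≤ q → 2 * q + k = N →
      ∀ z : complexBetti Y (2 * q), IsAbsoluteHodgeClass N Y q z → z ∈ algebraicClasses Y q)
    (hX : IsSmoothProjective n X) (p : ℕ) (hp : 2 ≤ p) (c : complexBetti X (2 * p))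
    (hc : IsAbsoluteHodgeClass n X p c) : c ∈ algebraicClasses X p := by
  by_cases hle : n ≤ 2 * p + k
  · -- pad DOWN by `j = 2p + k − n` (bare pull-back)
    obtain ⟨j, hj⟩ : ∃ j, 2 * p + k = n + j := ⟨2 * p + k - n, by omega⟩
    rcases Nat.eq_zero_or_pos j with rfl | hj1
    · exact hk hX p hp (by omega) c hc
    · obtain ⟨B, hBd⟩ := exists_abelianVariety_dim_eq_succ ℂ (j - 1)
      have hBsp : IsSmoothProjective B.dim B.X := AbelianVariety.isSmoothProjective_holds (A := B)
      exact absoluteHodge_algebraic_of_prod_of_canonical hN hex hX B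
        (fun z hz ↦ hk (IsSmoothProjective.tensor_holds hX hBsp) p hp (by omega) z hz) c hc
  · -- pad UP by `j = n − 2p − k ≥ 1` (cup product with `κʲ`)
    obtain ⟨j, hj⟩ : ∃ j, 2 * p + k + j = n := ⟨n - 2 * p - k, by omega⟩
    obtain ⟨B, hBd⟩ := exists_abelianVariety_dim_eq_succ ℂ (j - 1)
    have hBsp : IsSmoothProjective B.dim B.X := AbelianVariety.isSmoothProjective_holds (A := B)
    obtain ⟨κ, hκ⟩ := exists_isPolarizationClass hBsp
    exact absoluteHodge_algebraic_of_middle_prod_of_canonical hN hex h21c hX hBsp hκ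
      (fun z hz ↦ hk (IsSmoothProjective.tensor_holds hX hBsp) (p + B.dim) (by omega) (by omega) z hz) c hc

/-- **THE PARENT NODE AT OFFSET `−k`, FOR EVERY `k`**: granted (N), (E), (c), `AbsoluteHodgeImpliesAlgebraic ↔` "on every smooth
projective complex `Y` of dimension `N`, every absolute Hodge class of codimension `q ≥ 2` with `2q + k = N` is algebraic" (`k = 0`:
gen 71's middle-degree form; `k = 1`: classes of codimension `q` on `(2q + 1)`-folds; any `k`: classes of codimension `q` on
`(2q + k)`-folds). Neither side is asserted; NO `B(X)`. [cite: CharlesSchnell2014Notes, §11.2.5 Conj. 11.2.18 and Cor. 11.2.12]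
[cite: Deligne1982HodgeCycles, §2 Example 2.1 (c), (d) (p. 16)] [cite: BrosnanFangNiePearlstein2009, §6 Lemma 48] -/
theorem absoluteHodgeImpliesAlgebraic_iff_belowMiddleBy_of_canonical (hN : chartConjugation_canonical)
    (hex : ∀ ⦃n : ℕ⦄ ⦃X : SchemeOver ℂ⦄, IsSmoothProjective n X →
      ∀ (σ : ℂ ≃+* ℂ) (p : ℕ) (c : complexBetti X (2 * p)), ∃ s, IsConjugateClass σ X (2 * p) c s)
    (h21c : deligne1982_lefschetz_absoluteHodge_iff) (k : ℕ) :
    AbsoluteHodgeImpliesAlgebraic ↔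
      ∀ ⦃N : ℕ⦄ ⦃Y : SchemeOver ℂ⦄, IsSmoothProjective N Y → ∀ q : ℕ, 2 ≤ q → 2 * q + k = N →
        ∀ z : complexBetti Y (2 * q), IsAbsoluteHodgeClass N Y q z → z ∈ algebraicClasses Y q :=
  ⟨fun h _ _ hY q _ _ z hz ↦ h hY q z hz,
    fun h ↦ (absoluteHodgeImpliesAlgebraic_iff_lowerHalf h21c).2 fun _ _ hX p hp _ c hc ↦
      forall_absoluteHodge_algebraic_of_two_le_of_belowMiddleBy_of_canonical hN hex h21c k h hX p hp c hc⟩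

end Parent

/-! ## §2 Row b06 at a fixed offset `±k` from the middle (modulo (N)+(E)+(c)) -/

section Row

/-- **PER ABELIAN VARIETY, OFFSET `+k`**: granted (N), (E), (c), if on every complex abelian variety `C` every absolute Hodge class of
codimension `q` with `2q = dim C + k`, `2 ≤ q ≤ dim C − 2` is algebraic, then on the abelian variety `A` every absolute Hodge class of
codimension `2 ≤ p`, `2p ≤ dim A` is algebraic (pad UP by a polarised abelian `B`, `(A × B).X = A.X × B.X`; gen 71's Gysin descent).
The hypothesis is NOT asserted. [cite: Deligne1982HodgeCycles, §2 Example 2.1 (c), (d) (p. 16)] [cite: VoisinHodgeII2003, §9.2.4 Prop. 9.21]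
[cite: MumfordAV1970, §1] -/
theorem forall_absoluteHodge_algebraic_abelian_lowerHalf_of_aboveMiddleBy_of_canonical (hN : chartConjugation_canonical)
    (hex : ∀ ⦃n : ℕ⦄ ⦃X : SchemeOver ℂ⦄, IsSmoothProjective n X →
      ∀ (σ : ℂ ≃+* ℂ) (p : ℕ) (c : complexBetti X (2 * p)), ∃ s, IsConjugateClass σ X (2 * p) c s)
    (h21c : deligne1982_lefschetz_absoluteHodge_iff) (k : ℕ)
    (hk : ∀ (C : AbelianVariety ℂ) (q : ℕ), 2 ≤ q → q + 2 ≤ C.dim → 2 * q = C.dim + k →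
      ∀ z : complexBetti C.X (2 * q), IsAbsoluteHodgeClass C.dim C.X q z → z ∈ algebraicClasses C.X q)
    (A : AbelianVariety ℂ) (p : ℕ) (hp : 2 ≤ p) (hpn : 2 * p ≤ A.dim) (c : complexBetti A.X (2 * p))
    (hc : IsAbsoluteHodgeClass A.dim A.X p c) : c ∈ algebraicClasses A.X p := by
  have hA : IsSmoothProjective A.dim A.X := AbelianVariety.isSmoothProjective_holds (A := A)
  obtain ⟨j, hj⟩ : ∃ j, 2 * p + j = A.dim + k := ⟨A.dim + k - 2 * p, by omega⟩
  rcases Nat.eq_zero_or_pos j with rfl | hj1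
  · exact hk A p hp (by omega) (by omega) c hc
  · obtain ⟨B, hBd⟩ := exists_abelianVariety_dim_eq_succ ℂ (j - 1)
    have hBsp : IsSmoothProjective B.dim B.X := AbelianVariety.isSmoothProjective_holds (A := B)
    obtain ⟨κ, hκ⟩ := exists_isPolarizationClass hBsp
    refine absoluteHodge_algebraic_of_middle_prod_of_canonical hN hex h21c hA hBsp hκ (fun z hz ↦ ?_) c hc
    have h := hk (A.prod B) (p + B.dim) (by omega) (by rw [AbelianVariety.dim_prod]; omega)
      (by rw [AbelianVariety.dim_prod]; omega) z
    rw [AbelianVariety.dim_prod] at h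
    exact h hz

/-- **ROW b06 AT OFFSET `+k`, FOR EVERY `k`**: granted (N), (E), (c), `AbsoluteHodgeImpliesAlgebraicAV ↔` "on every complex
abelian variety `C`, every absolute Hodge class of codimension `q` with `2q = dim C + k` and `2 ≤ q ≤ dim C − 2` is algebraic"
(`k = 0`: gen 69's middle-degree form). Lower half by the previous theorem, the rest by gen 68's
`absoluteHodgeImpliesAlgebraicAV_iff_lowerHalf`. Row b06 is NOT asserted. [cite: Deligne1982HodgeCycles, §2 Example 2.1 (c), (d) (p. 16)]
[cite: BrosnanFangNiePearlstein2009, §6 Lemma 48] [cite: KerrPearlstein2011, §3.1] -/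
theorem absoluteHodgeImpliesAlgebraicAV_iff_aboveMiddleBy_of_canonical (hN : chartConjugation_canonical)
    (hex : ∀ ⦃n : ℕ⦄ ⦃X : SchemeOver ℂ⦄, IsSmoothProjective n X →
      ∀ (σ : ℂ ≃+* ℂ) (p : ℕ) (c : complexBetti X (2 * p)), ∃ s, IsConjugateClass σ X (2 * p) c s)
    (h21c : deligne1982_lefschetz_absoluteHodge_iff) (k : ℕ) :
    AbsoluteHodgeImpliesAlgebraicAV ↔
      ∀ (C : AbelianVariety ℂ) (q : ℕ), 2 ≤ q → q + 2 ≤ C.dim → 2 * q = C.dim + k →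
        ∀ z : complexBetti C.X (2 * q), IsAbsoluteHodgeClass C.dim C.X q z → z ∈ algebraicClasses C.X q :=
  ⟨fun h C q _ _ _ z hz ↦ h C q z hz,
    fun h ↦ (absoluteHodgeImpliesAlgebraicAV_iff_lowerHalf h21c).2 fun A p hp hpn c hc ↦
      forall_absoluteHodge_algebraic_abelian_lowerHalf_of_aboveMiddleBy_of_canonical hN hex h21c k h A p hp hpn c hc⟩

/-- **PER ABELIAN VARIETY, OFFSET `−k`**: granted (N), (E), (c), if on every complex abelian variety `C` every absolute Hodge class of
codimension `q ≥ 2` with `2q + k = dim C` is algebraic, then on the abelian variety `A` every absolute Hodge class of codimension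
`p ≥ 2` is algebraic (pad DOWN by bare pull-back to `A × B`, gen 69, or UP by `κʲ`, gen 71). The hypothesis is NOT
asserted. [cite: Deligne1982HodgeCycles, §2 Example 2.1 (c), (d) (p. 16)] [cite: CharlesSchnell2014Notes, §11.2.2 (11.2.2) and Prop. 11.3.11 (proof)]
[cite: VoisinHodgeII2003, §9.2.4 Prop. 9.21] [cite: MumfordAV1970, §1] -/
theorem forall_absoluteHodge_algebraic_abelian_of_two_le_of_belowMiddleBy_of_canonical (hN : chartConjugation_canonical)
    (hex : ∀ ⦃n : ℕ⦄ ⦃X : SchemeOver ℂ⦄, IsSmoothProjective n X →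
      ∀ (σ : ℂ ≃+* ℂ) (p : ℕ) (c : complexBetti X (2 * p)), ∃ s, IsConjugateClass σ X (2 * p) c s)
    (h21c : deligne1982_lefschetz_absoluteHodge_iff) (k : ℕ)
    (hk : ∀ (C : AbelianVariety ℂ) (q : ℕ), 2 ≤ q → 2 * q + k = C.dim →
      ∀ z : complexBetti C.X (2 * q), IsAbsoluteHodgeClass C.dim C.X q z → z ∈ algebraicClasses C.X q)
    (A : AbelianVariety ℂ) (p : ℕ) (hp : 2 ≤ p) (c : complexBetti A.X (2 * p))
    (hc : IsAbsoluteHodgeClass A.dim A.X p c) : c ∈ algebraicClasses A.X p := by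
  have hA : IsSmoothProjective A.dim A.X := AbelianVariety.isSmoothProjective_holds (A := A)
  by_cases hle : A.dim ≤ 2 * p + k
  · -- pad DOWN by `j = 2p + k − dim A` (bare pull-back)
    obtain ⟨j, hj⟩ : ∃ j, 2 * p + k = A.dim + j := ⟨2 * p + k - A.dim, by omega⟩
    rcases Nat.eq_zero_or_pos j with rfl | hj1
    · exact hk A p hp (by omega) c hc
    · obtain ⟨B, hBd⟩ := exists_abelianVariety_dim_eq_succ ℂ (j - 1)
      refine absoluteHodge_algebraic_of_prod_of_canonical hN hex hA B (fun z hz ↦ ?_) c hc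
      have h := hk (A.prod B) p hp (by rw [AbelianVariety.dim_prod]; omega) z
      rw [AbelianVariety.dim_prod] at h
      exact h hz
  · -- pad UP by `j = dim A − 2p − k ≥ 1` (cup product with `κʲ`)
    obtain ⟨j, hj⟩ : ∃ j, 2 * p + k + j = A.dim := ⟨A.dim - 2 * p - k, by omega⟩
    obtain ⟨B, hBd⟩ := exists_abelianVariety_dim_eq_succ ℂ (j - 1)
    have hBsp : IsSmoothProjective B.dim B.X := AbelianVariety.isSmoothProjective_holds (A := B)
    obtain ⟨κ, hκ⟩ := exists_isPolarizationClass hBsp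
    refine absoluteHodge_algebraic_of_middle_prod_of_canonical hN hex h21c hA hBsp hκ (fun z hz ↦ ?_) c hc
    have h := hk (A.prod B) (p + B.dim) (by omega) (by rw [AbelianVariety.dim_prod]; omega) z
    rw [AbelianVariety.dim_prod] at h
    exact h hz

/-- **ROW b06 AT OFFSET `−k`, FOR EVERY `k`**: granted (N), (E), (c), `AbsoluteHodgeImpliesAlgebraicAV ↔` "on every complex
abelian variety `C`, every absolute Hodge class of codimension `q ≥ 2` with `2q + k = dim C` is algebraic" (`k = 0`: gen 69; any
`k`: absolute Hodge classes of codimension `q` on abelian `(2q + k)`-folds). Row b06 is NOT asserted.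
[cite: Deligne1982HodgeCycles, §2 Example 2.1 (c), (d) (p. 16)] [cite: BrosnanFangNiePearlstein2009, §6 Lemma 48]
[cite: KerrPearlstein2011, §3.1] -/
theorem absoluteHodgeImpliesAlgebraicAV_iff_belowMiddleBy_of_canonical (hN : chartConjugation_canonical)
    (hex : ∀ ⦃n : ℕ⦄ ⦃X : SchemeOver ℂ⦄, IsSmoothProjective n X →
      ∀ (σ : ℂ ≃+* ℂ) (p : ℕ) (c : complexBetti X (2 * p)), ∃ s, IsConjugateClass σ X (2 * p) c s)
    (h21c : deligne1982_lefschetz_absoluteHodge_iff) (k : ℕ) :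
    AbsoluteHodgeImpliesAlgebraicAV ↔
      ∀ (C : AbelianVariety ℂ) (q : ℕ), 2 ≤ q → 2 * q + k = C.dim →
        ∀ z : complexBetti C.X (2 * q), IsAbsoluteHodgeClass C.dim C.X q z → z ∈ algebraicClasses C.X q :=
  ⟨fun h C q _ _ z hz ↦ h C q z hz,
    fun h ↦ (absoluteHodgeImpliesAlgebraicAV_iff_lowerHalf h21c).2 fun A p hp _ c hc ↦
      forall_absoluteHodge_algebraic_abelian_of_two_le_of_belowMiddleBy_of_canonical hN hex h21c k h A p hp c hc⟩

/-- **The `¬`-form at a prescribed offset**: granted (N), (E), (c), a counterexample to row b06, if any, can be taken of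
codimension `q` on an abelian variety of dimension EXACTLY `2q + k`, for any `k` fixed in advance. Neither side is asserted.
[cite: Deligne1982HodgeCycles, §2 Example 2.1 (c), (d) (p. 16)] [cite: BrosnanFangNiePearlstein2009, §6 Lemma 48] -/
theorem not_absoluteHodgeImpliesAlgebraicAV_iff_exists_belowMiddleBy_of_canonical (hN : chartConjugation_canonical)
    (hex : ∀ ⦃n : ℕ⦄ ⦃X : SchemeOver ℂ⦄, IsSmoothProjective n X →
      ∀ (σ : ℂ ≃+* ℂ) (p : ℕ) (c : complexBetti X (2 * p)), ∃ s, IsConjugateClass σ X (2 * p) c s)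
    (h21c : deligne1982_lefschetz_absoluteHodge_iff) (k : ℕ) :
    ¬ AbsoluteHodgeImpliesAlgebraicAV ↔
      ∃ (C : AbelianVariety ℂ) (q : ℕ), 2 ≤ q ∧ 2 * q + k = C.dim ∧
        ∃ z : complexBetti C.X (2 * q), IsAbsoluteHodgeClass C.dim C.X q z ∧ z ∉ algebraicClasses C.X q := by
  rw [absoluteHodgeImpliesAlgebraicAV_iff_belowMiddleBy_of_canonical hN hex h21c k]
  push Not
  exact Iff.rfl

end Row

/-! ## §3 Keyed to the named facts (N), (G), (c) -/

section Grothendieck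

/-- **The parent node at offset `+k`, keyed to (N), (G), (c)** ((E) from Grothendieck's comparison fact (G), gen 69's
`exists_isConjugateClass_even_of_grothendieck`). None of (N), (G), (c) is asserted. [cite: CharlesSchnell2014Notes, §11.2.2 (11.2.1)–(11.2.3) and Conj. 11.2.18]
[cite: Deligne1982HodgeCycles, §2 Example 2.1 (c), (d) (p. 16)] -/
theorem absoluteHodgeImpliesAlgebraic_iff_aboveMiddleBy_of_grothendieck (hN : chartConjugation_canonical)
    (hG : grothendieck_comparison_realize_surjective) (h21c : deligne1982_lefschetz_absoluteHodge_iff) (k : ℕ) :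
    AbsoluteHodgeImpliesAlgebraic ↔
      ∀ ⦃N : ℕ⦄ ⦃Y : SchemeOver ℂ⦄, IsSmoothProjective N Y → ∀ q : ℕ, 2 ≤ q → q + 2 ≤ N → 2 * q = N + k →
        ∀ z : complexBetti Y (2 * q), IsAbsoluteHodgeClass N Y q z → z ∈ algebraicClasses Y q :=
  absoluteHodgeImpliesAlgebraic_iff_aboveMiddleBy_of_canonical hN (exists_isConjugateClass_even_of_grothendieck hG) h21c k

/-- **The parent node at offset `−k`, keyed to (N), (G), (c)**. None of (N), (G), (c) is asserted.
[cite: CharlesSchnell2014Notes, §11.2.2 (11.2.1)–(11.2.3) and Conj. 11.2.18] [cite: Deligne1982HodgeCycles, §2 Example 2.1 (c), (d) (p. 16)] -/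
theorem absoluteHodgeImpliesAlgebraic_iff_belowMiddleBy_of_grothendieck (hN : chartConjugation_canonical)
    (hG : grothendieck_comparison_realize_surjective) (h21c : deligne1982_lefschetz_absoluteHodge_iff) (k : ℕ) :
    AbsoluteHodgeImpliesAlgebraic ↔
      ∀ ⦃N : ℕ⦄ ⦃Y : SchemeOver ℂ⦄, IsSmoothProjective N Y → ∀ q : ℕ, 2 ≤ q → 2 * q + k = N →
        ∀ z : complexBetti Y (2 * q), IsAbsoluteHodgeClass N Y q z → z ∈ algebraicClasses Y q :=
  absoluteHodgeImpliesAlgebraic_iff_belowMiddleBy_of_canonical hN (exists_isConjugateClass_even_of_grothendieck hG) h21c k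

/-- **Row b06 at offset `−k`, keyed to (N), (G), (c)**. None of (N), (G), (c) is asserted; row b06 is NOT asserted.
[cite: CharlesSchnell2014Notes, §11.2.2 (11.2.1)–(11.2.3)] [cite: Deligne1982HodgeCycles, §2 Example 2.1 (c), (d) (p. 16)] -/
theorem absoluteHodgeImpliesAlgebraicAV_iff_belowMiddleBy_of_grothendieck (hN : chartConjugation_canonical)
    (hG : grothendieck_comparison_realize_surjective) (h21c : deligne1982_lefschetz_absoluteHodge_iff) (k : ℕ) :
    AbsoluteHodgeImpliesAlgebraicAV ↔
      ∀ (C : AbelianVariety ℂ) (q : ℕ), 2 ≤ q → 2 * q + k = C.dim →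
        ∀ z : complexBetti C.X (2 * q), IsAbsoluteHodgeClass C.dim C.X q z → z ∈ algebraicClasses C.X q :=
  absoluteHodgeImpliesAlgebraicAV_iff_belowMiddleBy_of_canonical hN (exists_isConjugateClass_even_of_grothendieck hG) h21c k

end Grothendieck

/-! ## Audit: nothing is decided here

No theorem above concludes `AbsoluteHodgeImpliesAlgebraic`, `AbsoluteHodgeImpliesAlgebraicAV`, `HC_AV` or `HC_CM` outright:
every statement carries the undischarged hypotheses (N), (E)/(G), (c) (named facts of the tree, displayed, never asserted) and
an offset-`k` hypothesis. Axiom closures: the three standard axioms. -/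

#print axioms Summit.HodgeConjecture.HodgeConjecture.Ring2.Hypotheses.absoluteHodgeImpliesAlgebraic_iff_aboveMiddleBy_of_canonical
#print axioms Summit.HodgeConjecture.HodgeConjecture.Ring2.Hypotheses.absoluteHodgeImpliesAlgebraicAV_iff_belowMiddleBy_of_canonical

end Summit.HodgeConjecture.HodgeConjecture.Ring2.Hypotheses

end
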